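import Summits.QuantumFields.YangMills.Theorems.SourcedPressureJensenSourcedPressureDecouplingHolderAverage
import Literature.MathematicalPhysics.QuantumFieldTheory.LatticeGaugeProofs
import Literature.MathematicalPhysics.QuantumLattice.LatticeGaugeDLRGibbsProofs
import HarnessLib

/-!
# Route `SourcedPressureJensen`, crux `SourcedPressureDecoupling` (stmt-QuantumFields-24028): TRANSLATION-AVERAGED JENSEN
# on the torus — a torus-summed source is dominated by ANY sub-family of its translates at a rescaled strength

Mechanism (1) of the item, in the route's own currency.  For a continuous `ℤ⁴`-observable `g` (e.g. the centred two-plaquette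
source density `(βc₀ − m)(βc_{ne₀} − m)`), its torus translates `H_x = (g ∘ θ_{−x})^{Λ}` (`x ∈ Λ = (Fin (L+1))⁴`,
`toTorusObservable ∘ configShift`, exactly as in `SourcedPressureIncrement` / `SourcedPressureDecoupling`), ANY nonempty set of
sites `P ⊂ Λ` and any real `c`:

  `log E[exp(c · Σ_{x∈Λ} H_x)] ≤ log E[exp((c·|Λ|/|P|) · Σ_{y∈P} H_y)]`   (`translationAveraged_jensen`)

— because `Σ_x H_x` is the AVERAGE over all torus translations `a` of `(|Λ|/|P|)·Σ_{y∈P} H_{y+a}` (each site is hit `|P|` times: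
`sum_translates_eq_avg`), the log-partition functional `F ↦ log E e^F` is convex along finite averages
(`log_wilsonExpectation_exp_avg_le`, finite Hölder), and every translate has the same exponential moment (torus translation
invariance `wilsonExpectation_comp_torusConfigShift`; `H_{y+a} = H_y ∘ τ`, `translate_add_apply`).  With `P` = the pairs interior
to a cell tiling, the straddling pairs are removed EXACTLY at the price `c ↦ c|Λ|/|P| = c/(1−f)`, as the planner's step (1) asserts.

Everything is proved; no definition, no named fact.  RECORD-label rung support (route target `XiPow` = an upper bound on the
lattice gap); the Yang–Mills mass gap is NOT proved by anything here. [folklore]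
-/

set_option autoImplicit false

noncomputable section

open MeasureTheory Real Finset
open Literature.MathematicalPhysics.QuantumFieldTheory Literature.MathematicalPhysics.QuantumLattice
open Literature.Probability.LatticeModels

namespace Summit.QuantumFields.YangMills.Theorems.SourcedPressureJensen

variable {G : Type} [Group G] [TopologicalSpace G] [IsTopologicalGroup G] [CompactSpace G]
  [MeasurableSpace G] [BorelSpace G]

/-! ### Torus translates of a `ℤ⁴` observable -/

omit [Group G] [TopologicalSpace G] [IsTopologicalGroup G] [CompactSpace G] [BorelSpace G] in
/-- The torus shift attached to a site `x ∈ (Fin (L+1))⁴`: reduction mod `L+1` of `−x` (the shift under which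
`(g ∘ θ_{−x})^{Λ} = g^{Λ} ∘ τ`, `toTorusObservable_comp_configShift`). [folklore] -/
theorem toTorusObservable_translate_eq (L : ℕ) (g : LGConfig 4 G → ℝ) (x : Fin 4 → Fin (L + 1)) :
    toTorusObservable (L + 1) (fun V => g (configShift (fun i => -((x i : ℕ) : ℤ)) V)) =
      toTorusObservable (L + 1) g ∘
        Literature.MathematicalPhysics.QuantumFieldTheory.torusConfigShift
          (Torus.proj (L + 1) (fun i => -((x i : ℕ) : ℤ))) := by
  have h : (fun V => g (configShift (fun i => -((x i : ℕ) : ℤ)) V)) = g ∘ configShift (fun i => -((x i : ℕ) : ℤ)) := rfl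
  rw [h, toTorusObservable_comp_configShift]

omit [Group G] [TopologicalSpace G] [IsTopologicalGroup G] [CompactSpace G] [BorelSpace G] in
/-- Torus shifts compose additively: `τ_{u+v} = τ_u ∘ τ_v`. [folklore] -/
theorem torusConfigShift_add_apply {d L : ℕ} (u v : Site d L) (U : GaugeConfig d L G) :
    Literature.MathematicalPhysics.QuantumFieldTheory.torusConfigShift (u + v) U =
      Literature.MathematicalPhysics.QuantumFieldTheory.torusConfigShift u
        (Literature.MathematicalPhysics.QuantumFieldTheory.torusConfigShift v U) := by
  funext e
  simp only [Literature.MathematicalPhysics.QuantumFieldTheory.torusConfigShift_apply]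
  congr 1
  simp only [Prod.mk.injEq, and_true]
  abel

/-- The reduction map `x ↦ proj(−x̂)` is additive on `(Fin (L+1))⁴`. [folklore] -/
theorem proj_neg_natCast_add (L : ℕ) (y a : Fin 4 → Fin (L + 1)) :
    Torus.proj (L + 1) (fun i => -(((y + a) i : ℕ) : ℤ)) =
      Torus.proj (L + 1) (fun i => -((y i : ℕ) : ℤ)) + Torus.proj (L + 1) (fun i => -((a i : ℕ) : ℤ)) := by
  funext i
  simp only [Torus.proj_apply, Pi.add_apply, Fin.val_add, Int.cast_neg, Int.cast_natCast, ZMod.natCast_mod,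
    Nat.cast_add, neg_add]

omit [Group G] [TopologicalSpace G] [IsTopologicalGroup G] [CompactSpace G] [BorelSpace G] in
/-- **Translates compose**: `H_{y+a} = H_y ∘ τ_{proj(−â)}` for the torus translates `H_x = (g ∘ θ_{−x})^{Λ}`. [folklore] -/
theorem translate_add_apply (L : ℕ) (g : LGConfig 4 G → ℝ) (y a : Fin 4 → Fin (L + 1)) (U : GaugeConfig 4 (L + 1) G) :
    toTorusObservable (L + 1) (fun V => g (configShift (fun i => -(((y + a) i : ℕ) : ℤ)) V)) U =
      toTorusObservable (L + 1) (fun V => g (configShift (fun i => -((y i : ℕ) : ℤ)) V))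
        (Literature.MathematicalPhysics.QuantumFieldTheory.torusConfigShift
          (Torus.proj (L + 1) (fun i => -((a i : ℕ) : ℤ))) U) := by
  rw [toTorusObservable_translate_eq, toTorusObservable_translate_eq, Function.comp_apply, Function.comp_apply,
    proj_neg_natCast_add, torusConfigShift_add_apply]

/-- **Each site is hit `|P|` times**: `Σ_{a∈Λ} Σ_{y∈P} H (y + a) = |P| · Σ_{x∈Λ} H x` on the finite group `Λ = (Fin (L+1))⁴`.
[folklore] -/
theorem sum_sum_translates_eq_card_mul {L : ℕ} {α : Type*} [AddCommMonoid α] (H : (Fin 4 → Fin (L + 1)) → α)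
    (P : Finset (Fin 4 → Fin (L + 1))) :
    ∑ a : Fin 4 → Fin (L + 1), ∑ y ∈ P, H (y + a) = P.card • ∑ x : Fin 4 → Fin (L + 1), H x := by
  rw [Finset.sum_comm]
  have h : ∀ y ∈ P, ∑ a : Fin 4 → Fin (L + 1), H (y + a) = ∑ x : Fin 4 → Fin (L + 1), H x := fun y _ =>
    Fintype.sum_equiv (Equiv.addLeft y) _ _ fun a => rfl
  rw [Finset.sum_congr rfl h, Finset.sum_const]

/-! ### Translation-averaged Jensen -/

omit [Group G] [IsTopologicalGroup G] [CompactSpace G] [BorelSpace G] in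
/-- Continuity of a torus translate of a continuous `ℤ⁴` observable. [folklore] -/
theorem continuous_translate (L : ℕ) {g : LGConfig 4 G → ℝ} (hg : Continuous g) (x : Fin 4 → Fin (L + 1)) :
    Continuous (toTorusObservable (G := G) (L + 1) (fun V => g (configShift (fun i => -((x i : ℕ) : ℤ)) V))) := by
  have hcs : Continuous (configShift (d := 4) (G := G) (fun i => -((x i : ℕ) : ℤ))) := by
    refine continuous_pi fun e => ?_
    simp only [Literature.MathematicalPhysics.QuantumLattice.configShift_apply]
    exact continuous_apply _
  exact (hg.comp hcs).comp (continuous_torusLift (L + 1))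

/-- **TRANSLATION-AVERAGED JENSEN on the torus.**  For a lattice representation `r`, `β`, a continuous `ℤ⁴` observable `g` with
torus translates `H_x(U) = g^{Λ}(θ_{−x}·U)` (`x ∈ Λ = (Fin (L+1))⁴`), any nonempty `P ⊂ Λ` and any real `c`:
`log E[exp(c Σ_{x∈Λ} H_x)] ≤ log E[exp((c·(L+1)⁴/|P|) Σ_{y∈P} H_y)]`.  (`Σ_x H_x` is the average over the `(L+1)⁴` torus
translations `a` of `((L+1)⁴/|P|) Σ_{y∈P} H_{y+a}`; convexity of `F ↦ log E e^F` and translation invariance.) [folklore] -/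
theorem translationAveraged_jensen (r : LatticeRep G) (β : ℝ) (L : ℕ) {g : LGConfig 4 G → ℝ} (hg : Continuous g)
    (c : ℝ) (P : Finset (Fin 4 → Fin (L + 1))) (hP : P.Nonempty) :
    Real.log (wilsonExpectation (L := L + 1) r.ρ β fun U =>
        Real.exp (c * ∑ x : Fin 4 → Fin (L + 1),
          toTorusObservable (L + 1) (fun V => g (configShift (fun i => -((x i : ℕ) : ℤ)) V)) U)) ≤
      Real.log (wilsonExpectation (L := L + 1) r.ρ β fun U =>
        Real.exp ((c * (L + 1 : ℝ) ^ 4 / P.card) * ∑ y ∈ P,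
          toTorusObservable (L + 1) (fun V => g (configShift (fun i => -((y i : ℕ) : ℤ)) V)) U)) := by
  -- abbreviations
  set H : (Fin 4 → Fin (L + 1)) → GaugeConfig 4 (L + 1) G → ℝ :=
    fun x => toTorusObservable (L + 1) (fun V => g (configShift (fun i => -((x i : ℕ) : ℤ)) V)) with hH
  have hHc : ∀ x, Continuous (H x) := fun x => continuous_translate L hg x
  set N : ℝ := ((Fintype.card (Fin 4 → Fin (L + 1)) : ℕ) : ℝ) with hN
  have hNval : N = (L + 1 : ℝ) ^ 4 := by
    rw [hN, Fintype.card_fun, Fintype.card_fin, Fintype.card_fin]; push_cast; ring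
  have hNpos : 0 < N := by rw [hNval]; positivity
  have hPpos : (0 : ℝ) < P.card := by exact_mod_cast hP.card_pos
  -- the translated family
  set F : (Fin 4 → Fin (L + 1)) → GaugeConfig 4 (L + 1) G → ℝ :=
    fun a U => (c * N / P.card) * ∑ y ∈ P, H (y + a) U with hF
  have hFc : ∀ a ∈ (Finset.univ : Finset (Fin 4 → Fin (L + 1))), Continuous (F a) := fun a _ => by
    simp only [hF]
    exact continuous_const.mul (continuous_finsetSum _ fun y _ => hHc (y + a))
  -- (1) the torus sum is the average of the translated family
  have havg : ∀ U, c * ∑ x : Fin 4 → Fin (L + 1), H x U =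
      ((Finset.univ : Finset (Fin 4 → Fin (L + 1))).card : ℝ)⁻¹ * ∑ a : Fin 4 → Fin (L + 1), F a U := by
    intro U
    have hcount := sum_sum_translates_eq_card_mul (fun x => H x U) P
    simp only [hF, ← Finset.mul_sum, Finset.card_univ]
    rw [hcount, nsmul_eq_mul, ← hN]
    field_simp
  -- (2) every translate has the same exponential moment
  have hinv : ∀ a : Fin 4 → Fin (L + 1),
      wilsonExpectation (L := L + 1) r.ρ β (fun U => Real.exp (F a U)) =
        wilsonExpectation (L := L + 1) r.ρ β (fun U => Real.exp (F 0 U)) := by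
    intro a
    have hshift : (fun U => Real.exp (F a U)) = (fun U => Real.exp (F 0 U)) ∘
        Literature.MathematicalPhysics.QuantumFieldTheory.torusConfigShift
          (Torus.proj (L + 1) (fun i => -((a i : ℕ) : ℤ))) := by
      funext U
      simp only [hF, hH, Function.comp_apply, add_zero]
      congr 2
      exact Finset.sum_congr rfl fun y _ => translate_add_apply L g y a U
    rw [hshift, wilsonExpectation_comp_torusConfigShift]
  -- (3) Hölder / convexity of the log-partition functional along the average
  have hJ := log_wilsonExpectation_exp_avg_le r β (Finset.univ : Finset (Fin 4 → Fin (L + 1)))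
    Finset.univ_nonempty hFc
  have hlhs : (fun U : GaugeConfig 4 (L + 1) G => Real.exp (c * ∑ x : Fin 4 → Fin (L + 1), H x U)) =
      fun U => Real.exp (((Finset.univ : Finset (Fin 4 → Fin (L + 1))).card : ℝ)⁻¹ *
        ∑ a : Fin 4 → Fin (L + 1), F a U) := by
    funext U; rw [havg U]
  have hrhs : ((Finset.univ : Finset (Fin 4 → Fin (L + 1))).card : ℝ)⁻¹ *
      ∑ a : Fin 4 → Fin (L + 1), Real.log (wilsonExpectation (L := L + 1) r.ρ β fun U => Real.exp (F a U)) =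
      Real.log (wilsonExpectation (L := L + 1) r.ρ β fun U => Real.exp (F 0 U)) := by
    rw [Finset.sum_congr rfl fun a _ => by rw [hinv a], Finset.sum_const, Finset.card_univ, nsmul_eq_mul, ← hN,
      ← mul_assoc, inv_mul_cancel₀ hNpos.ne', one_mul]
  have hF0 : (fun U => Real.exp (F 0 U)) =
      fun U => Real.exp ((c * (L + 1 : ℝ) ^ 4 / P.card) * ∑ y ∈ P, H y U) := by
    funext U
    simp only [hF, add_zero, hNval]
  show Real.log (wilsonExpectation (L := L + 1) r.ρ β fun U => Real.exp (c * ∑ x : Fin 4 → Fin (L + 1), H x U)) ≤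
    Real.log (wilsonExpectation (L := L + 1) r.ρ β fun U =>
      Real.exp ((c * (L + 1 : ℝ) ^ 4 / P.card) * ∑ y ∈ P, H y U))
  rw [hlhs, ← hF0, ← hrhs]
  exact hJ

end Summit.QuantumFields.YangMills.Theorems.SourcedPressureJensen

end
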